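import Summits.RiemannHypothesis.RiemannHypothesis.Theorems.HandoffTranslatedKernel
import Summits.RiemannHypothesis.RiemannHypothesis.Theorems.HandoffOffDiag
import HarnessLib

/-!
# HANDOFF — the TRANSLATE PAIR `θ(· − c) − θ(· + c)`: kernel, contribution and energy (cell rh-explicit, TRACK «HANDOFF», seat prove-2, ATTEMPT-14, part 2/3)

HONEST FRAMING. Nothing here bears on the truth of RH. RH-free bookkeeping for idea-3's UV-FLOOR lemma of the handoff
capacity (hand-off P-G14-1; consumer `HandoffCapacityUVFloor.lean`). For a Weil test function `θ` supported in the tiny window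
`[−δ, δ]`, a prime `q`, `c = (log q)/2`, `L = 2c = log q`, `0 < δ < 1/(2(q+1))`, the DIFFERENCE OF TRANSLATES

  `G(x) = θ(x − c) − θ(x + c)`  (two copies of the SAME profile at `±c`, opposite signs)

is a test function on `C(c + δ)` with `‖G‖₂² = 2‖θ‖₂²`; its kernel is `k_G = 2k_θ − k_θ(· − L) − k_θ(· + L)`
(`weilConv_weilReflect_translatePair`), so `k_G(±L) = −‖θ‖₂²` and **`contribution_q(G) = (2 log q/√q)·‖θ‖₂²` EXACTLY**
(`contribution_translatePair`: the only prime power within `2δ < 1/(q+1)` of `log q` is `q`), and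
**`Re Q(G) ≤ 2 Re Q(θ) + (2 log q/√q + 8δ·M(c − δ) + 8(e^{c} + e^{−c})δ³)·‖θ‖₂²`** (`re_weilQuadratic_translatePair_le`,
`M = archGapBound`): the prime cross terms ARE the atom `q`; the polar cross terms have the GOOD sign up to
`(e^c + e^{−c})‖θ̂(0) − θ̂(1)‖² ≤ 8(e^c + e^{−c})δ³‖θ‖₂²`; the archimedean cross terms cost `≤ 8δM‖θ‖₂²`.
(idea-3's sketch writes the antisymmetric pair `θ(x − c) − θ(−x − c)`; that function has `k(±L) = −∫ θ(u)·conj θ(−u) du`,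
which is `−‖θ‖₂²` only for EVEN `θ` and `+‖θ‖₂²` for odd `θ` — for a general, non-symmetric near-minimiser the translate pair is
the right object; for even `θ` the two coincide, see `HandoffCapacityUVFloor.placeGain_collarPair_of_even`.)

References (as printed): E. Bombieri, Rend. Mat. Acc. Lincei (9) 11 (2000) Thm 2, §4 Lemma 2 (`|k| ≤ ‖g‖₂²`) [`Bombieri2000Weil`];
A. Connes, C. Consani, Enseign. Math. 69 (2023) §2.2–2.3 (the contribution of one prime on its window) [`ConnesConsani2023`].
The translate pair as the wall-making test function: this track (HANDOFF-STATEMENT §D.1; theory-2 `HandoffCapSharp.lean` for bumps).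
-/

set_option linter.dupNamespace false

noncomputable section

open Complex Filter Set MeasureTheory Literature.NumberTheory.LFunctions
open scoped Real Topology ComplexConjugate ContDiff ArithmeticFunction.vonMangoldt

namespace Summit.RiemannHypothesis.RiemannHypothesis.Theorems.Handoff

variable {θ : ℝ → ℂ} {q : ℕ}


section Pair

variable {δ c : ℝ}

/-- The translate pair is a Weil test function. [folklore] -/
theorem isWeilTest_translatePair (hθ : IsWeilTest θ) (c : ℝ) :
    IsWeilTest fun x ↦ θ (x - c) - θ (x + c) :=
  ⟨(isWeilTest_comp_sub hθ c).1.sub (isWeilTest_recentre hθ c).1,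
    (isWeilTest_comp_sub hθ c).2.sub (isWeilTest_recentre hθ c).2⟩

/-- Support of the translate pair: `⊆ [−(c + δ), c + δ]` (for `tsupport θ ⊆ [−δ, δ]`, `0 ≤ c`). [folklore] -/
theorem tsupport_translatePair_subset (hθs : tsupport θ ⊆ Icc (-δ) δ) (hc : 0 ≤ c) :
    tsupport (fun x ↦ θ (x - c) - θ (x + c)) ⊆ Icc (-(c + δ)) (c + δ) := by
  have h1 : tsupport (fun x ↦ θ (x - c)) ⊆ Icc (-δ + c) (δ + c) := tsupport_comp_sub_subset hθs c
  have h2 : tsupport (fun x ↦ θ (x + c)) ⊆ Icc (-δ + -c) (δ + -c) := by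
    have := tsupport_comp_sub_subset hθs (-c)
    simpa only [sub_neg_eq_add] using this
  have e : (fun x ↦ θ (x - c) - θ (x + c)) = (fun x ↦ θ (x - c)) - fun x ↦ θ (x + c) := rfl
  rw [e]
  refine (tsupport_sub _ _).trans (union_subset (h1.trans ?_) (h2.trans ?_))
  · exact Icc_subset_Icc (by linarith) (by linarith)
  · exact Icc_subset_Icc (by linarith) (by linarith)

/-- Pointwise, the two translates never overlap when `δ < c`: `θ(x − c)·(anything at x + c) …`; precisely
`‖θ(x − c) − θ(x + c)‖² = ‖θ(x − c)‖² + ‖θ(x + c)‖²`. [folklore] -/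
theorem norm_sq_translatePair (hθs : tsupport θ ⊆ Icc (-δ) δ) (hδc : δ < c) (x : ℝ) :
    ‖θ (x - c) - θ (x + c)‖ ^ 2 = ‖θ (x - c)‖ ^ 2 + ‖θ (x + c)‖ ^ 2 := by
  by_cases h1 : θ (x - c) = 0
  · simp [h1]
  by_cases h2 : θ (x + c) = 0
  · simp [h2]
  exfalso
  have m1 := hθs (subset_tsupport _ (Function.mem_support.2 h1))
  have m2 := hθs (subset_tsupport _ (Function.mem_support.2 h2))
  simp only [Set.mem_Icc] at m1 m2
  linarith [m1.1, m2.2]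

/-- **`‖G‖₂² = 2‖θ‖₂²`** for the translate pair `G = θ(· − c) − θ(· + c)`, `δ < c`. [folklore] -/
theorem integral_norm_sq_translatePair (hθ : IsWeilTest θ) (hθs : tsupport θ ⊆ Icc (-δ) δ) (hδc : δ < c) :
    ∫ x : ℝ, ‖θ (x - c) - θ (x + c)‖ ^ 2 = 2 * ∫ x : ℝ, ‖θ x‖ ^ 2 := by
  have h2 : Integrable fun u : ℝ ↦ ‖θ u‖ ^ 2 := hθ.integrable_norm_sq
  simp_rw [norm_sq_translatePair hθs hδc]
  rw [integral_add (h2.comp_sub_right c) (h2.comp_add_right c),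
    integral_sub_right_eq_self (fun u : ℝ ↦ ‖θ u‖ ^ 2) c, integral_add_right_eq_self (fun u : ℝ ↦ ‖θ u‖ ^ 2) c]
  ring

/-- **The kernel of the translate pair**: `k_G = 2k_θ − k_θ(· − 2c) − k_θ(· + 2c)`. [folklore] -/
theorem weilConv_weilReflect_translatePair (hθ : IsWeilTest θ) (c : ℝ) :
    weilConv (fun x ↦ θ (x - c) - θ (x + c)) (weilReflect fun x ↦ θ (x - c) - θ (x + c)) =
      fun y ↦ 2 * weilConv θ (weilReflect θ) y - weilConv θ (weilReflect θ) (y - 2 * c) -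
        weilConv θ (weilReflect θ) (y + 2 * c) := by
  set u : ℝ → ℂ := fun x ↦ θ (x - c) with hu_def
  set v : ℝ → ℂ := fun x ↦ θ (x - (-c)) with hv_def
  set w : ℝ → ℂ := fun x ↦ (-1 : ℂ) * v x with hw_def
  have hu : IsWeilTest u := isWeilTest_comp_sub hθ c
  have hv : IsWeilTest v := isWeilTest_comp_sub hθ (-c)
  have hw : IsWeilTest w := hv.const_mul (-1)
  have hG : (fun x ↦ θ (x - c) - θ (x + c)) = u + w := by
    funext x
    simp only [hu_def, hw_def, hv_def, Pi.add_apply, sub_neg_eq_add]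
    ring
  have hww : weilReflect w = fun t ↦ (-1 : ℂ) * weilReflect v t := by
    rw [hw_def, weilReflect_const_mul]; simp
  have kuu : weilConv u (weilReflect u) = weilConv θ (weilReflect θ) := weilConv_weilReflect_translate θ c
  have kvv : weilConv v (weilReflect v) = weilConv θ (weilReflect θ) := weilConv_weilReflect_translate θ (-c)
  have kww : weilConv w (weilReflect w) = weilConv θ (weilReflect θ) := by
    rw [hw_def, weilConv_weilReflect_const_mul, kvv]
    funext t; simp
  have kuv : weilConv u (weilReflect v) = fun y ↦ weilConv θ (weilReflect θ) (y - 2 * c) := by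
    rw [hu_def, hv_def, weilConv_translate_weilReflect_translate]
    funext y; ring_nf
  have kvu : weilConv v (weilReflect u) = fun y ↦ weilConv θ (weilReflect θ) (y + 2 * c) := by
    rw [hu_def, hv_def, weilConv_translate_weilReflect_translate]
    funext y; ring_nf
  have kuw : weilConv u (weilReflect w) = fun y ↦ (-1 : ℂ) * weilConv θ (weilReflect θ) (y - 2 * c) := by
    rw [hww, weilConv_const_mul_right, kuv]
  have kwu : weilConv w (weilReflect u) = fun y ↦ (-1 : ℂ) * weilConv θ (weilReflect θ) (y + 2 * c) := by
    rw [hw_def, weilConv_const_mul_left, kvu]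
  rw [hG, weilConv_weilReflect_add hu hw, kuu, kww, kuw, kwu]
  funext y
  simp only [Pi.add_apply]
  ring

/-- The translate pair's kernel at the lags `±2c` when `k_θ` vanishes at `±2c` and `±4c`:
`k_G(2c) = −k_θ(0) = k_G(−2c)`. [folklore] -/
theorem weilConv_weilReflect_translatePair_apply (hθ : IsWeilTest θ) (c : ℝ)
    (h2 : weilConv θ (weilReflect θ) (2 * c) = 0) (h2' : weilConv θ (weilReflect θ) (-(2 * c)) = 0)
    (h4 : weilConv θ (weilReflect θ) (2 * (2 * c)) = 0) (h4' : weilConv θ (weilReflect θ) (-(2 * (2 * c))) = 0) :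
    weilConv (fun x ↦ θ (x - c) - θ (x + c)) (weilReflect fun x ↦ θ (x - c) - θ (x + c)) (2 * c) =
        -weilConv θ (weilReflect θ) 0 ∧
      weilConv (fun x ↦ θ (x - c) - θ (x + c)) (weilReflect fun x ↦ θ (x - c) - θ (x + c)) (-(2 * c)) =
        -weilConv θ (weilReflect θ) 0 := by
  rw [weilConv_weilReflect_translatePair hθ c]
  simp only
  rw [show 2 * c - 2 * c = (0 : ℝ) by ring, show 2 * c + 2 * c = 2 * (2 * c) by ring,
    show -(2 * c) - 2 * c = -(2 * (2 * c)) by ring, show -(2 * c) + 2 * c = (0 : ℝ) by ring, h2, h2', h4, h4']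
  constructor <;> ring

variable (hq : q.Prime) (hθ : IsWeilTest θ) (hδ : 0 < δ) (hδq : δ < 1 / (2 * ((q : ℝ) + 1)))
  (hθs : tsupport θ ⊆ Icc (-δ) δ)
include hq hθ hδ hδq hθs

omit hθ hθs in
/-- Elementary consequences of `δ < 1/(2(q+1))` for a prime `q`: `2δ < 1/(q+1)`, `δ ≤ 1`, `δ < (log q)/2`. [folklore] -/
theorem translatePair_aux :
    2 * δ < 1 / ((q : ℝ) + 1) ∧ δ ≤ 1 ∧ δ < Real.log q / 2 := by
  have hq2 : (2 : ℝ) ≤ q := by exact_mod_cast hq.two_le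
  have h1 : 2 * δ < 1 / ((q : ℝ) + 1) := by
    rw [lt_div_iff₀ (by positivity)] at hδq ⊢; linarith
  have h2 : 1 / ((q : ℝ) + 1) ≤ 1 / 3 := by
    rw [div_le_div_iff₀ (by positivity) (by norm_num)]; linarith
  have hlog2 : (1 : ℝ) / 3 < Real.log 2 := by
    have := Real.log_two_gt_d9; norm_num at this ⊢; linarith
  have hL : Real.log 2 ≤ Real.log q := Real.log_le_log (by norm_num) hq2
  exact ⟨h1, by linarith, by linarith⟩

omit hq hδ hδq in
/-- `k_θ` vanishes off `[−2δ, 2δ]`. [folklore] -/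
theorem weilConv_weilReflect_eq_zero_of_lt_abs {s : ℝ} (hs : 2 * δ < |s|) : weilConv θ (weilReflect θ) s = 0 := by
  have hsupp := tsupport_weilConv_weilReflect_subset (a := δ) hθ.2 hθs
  by_contra hne
  have hmem := hsupp (subset_tsupport _ (Function.mem_support.2 hne))
  rw [Set.mem_Icc] at hmem
  have : |s| ≤ 2 * δ := abs_le.2 ⟨hmem.1, hmem.2⟩
  linarith

/-- **The contribution of `q` at the translate pair is `w_q‖θ‖₂²` EXACTLY**, `w_q = 2 log q/√q`
(`c = (log q)/2`; the only prime power within `2δ < 1/(q+1)` of `log q` is `q`). [cite: ConnesConsani2023, §2.2–2.3 (the contribution of a prime on its window); this track HANDOFF-STATEMENT §D.1] -/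
theorem contribution_translatePair :
    contribution q (fun x ↦ θ (x - Real.log q / 2) - θ (x + Real.log q / 2)) =
      2 * Real.log q / Real.sqrt q * ∫ x : ℝ, ‖θ x‖ ^ 2 := by
  obtain ⟨h2δ, -, -⟩ := translatePair_aux hq hδ hδq
  have hvan := translate_log_vanish (k := weilConv θ (weilReflect θ)) hq.two_le h2δ
    (fun s hs ↦ weilConv_weilReflect_eq_zero_of_lt_abs hθ hθs hs)
  obtain ⟨-, ⟨hL, hL'⟩, ⟨h2L, h2L'⟩⟩ := hvan
  have happ := weilConv_weilReflect_translatePair_apply hθ (Real.log q / 2)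
    (by rwa [mul_div_cancel₀ _ (two_ne_zero' ℝ)]) (by rwa [mul_div_cancel₀ _ (two_ne_zero' ℝ)])
    (by rwa [mul_div_cancel₀ _ (two_ne_zero' ℝ)]) (by rwa [mul_div_cancel₀ _ (two_ne_zero' ℝ)])
  rw [mul_div_cancel₀ _ (two_ne_zero' ℝ)] at happ
  unfold contribution
  rw [happ.1, happ.2, weilConv_weilReflect_apply_zero]
  rw [show (-((∫ t : ℝ, ‖θ t‖ ^ 2 : ℝ) : ℂ) + -((∫ t : ℝ, ‖θ t‖ ^ 2 : ℝ) : ℂ)) =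
    ((-(2 * ∫ t : ℝ, ‖θ t‖ ^ 2) : ℝ) : ℂ) by push_cast; ring, Complex.ofReal_re]
  ring

/-- **The energy of the translate pair** (`c = (log q)/2`):
`Re Q(G) ≤ 2 Re Q(θ) + (2 log q/√q + 8δ·M(c − δ) + 8(e^{c} + e^{−c})δ³)·‖θ‖₂²`, `M = archGapBound`.
Prime cross terms: the atom `q`, exactly `+(2 log q/√q)‖θ‖₂²`; polar cross terms: `−(e^c + e^{−c})·2Re(θ̂(0)·conj θ̂(1)) ≤
(e^c + e^{−c})‖θ̂(0) − θ̂(1)‖² ≤ 8(e^c + e^{−c})δ³‖θ‖₂²`; archimedean cross terms: `≤ 2·(2·2δ·M·‖θ‖₂²)`.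
[cite: Bombieri2000Weil, Thm 2 (the three terms of W) and §4 Lemma 2; this track ATTEMPT-14] -/
theorem re_weilQuadratic_translatePair_le :
    (weilQuadratic (fun x ↦ θ (x - Real.log q / 2) - θ (x + Real.log q / 2))).re ≤
      2 * (weilQuadratic θ).re +
        (2 * Real.log q / Real.sqrt q + 8 * δ * archGapBound (Real.log q / 2 - δ) +
          8 * (Real.exp (Real.log q / 2) + Real.exp (-(Real.log q / 2))) * δ ^ 3) * ∫ x : ℝ, ‖θ x‖ ^ 2 := by
  obtain ⟨h2δ, hδ1, hδc⟩ := translatePair_aux hq hδ hδq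
  set c : ℝ := Real.log q / 2 with hc_def
  have hL : Real.log q = 2 * c := by rw [hc_def]; ring
  have hc0 : 0 < c := hδ.trans hδc
  set kθ := weilConv θ (weilReflect θ) with hk_def
  have hk : IsWeilTest kθ := hθ.weilConv hθ.weilReflect
  set N2 : ℝ := ∫ x : ℝ, ‖θ x‖ ^ 2 with hN2_def
  have hN2 : 0 ≤ N2 := integral_nonneg fun _ ↦ by positivity
  have hkN : ∀ y, ‖kθ y‖ ≤ N2 := fun y ↦ norm_weilConv_weilReflect_le hθ y
  have hk0 : kθ 0 = (N2 : ℂ) := weilConv_weilReflect_apply_zero θ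
  have hkz : ∀ s : ℝ, 2 * δ < |s| → kθ s = 0 :=
    fun s hs ↦ weilConv_weilReflect_eq_zero_of_lt_abs hθ hθs hs
  -- the two lobes and the decomposition `G = u + w`
  set u : ℝ → ℂ := fun x ↦ θ (x - c) with hu_def
  set v : ℝ → ℂ := fun x ↦ θ (x - (-c)) with hv_def
  set w : ℝ → ℂ := fun x ↦ (-1 : ℂ) * v x with hw_def
  have hu : IsWeilTest u := isWeilTest_comp_sub hθ c
  have hv : IsWeilTest v := isWeilTest_comp_sub hθ (-c)
  have hw : IsWeilTest w := hv.const_mul (-1)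
  have hG : (fun x ↦ θ (x - c) - θ (x + c)) = u + w := by
    funext x
    simp only [hu_def, hw_def, hv_def, Pi.add_apply, sub_neg_eq_add]
    ring
  have hww : weilReflect w = fun t ↦ (-1 : ℂ) * weilReflect v t := by
    rw [hw_def, weilReflect_const_mul]; simp
  -- the translated kernels
  set K₁ : ℝ → ℂ := fun y ↦ kθ (y - 2 * c) with hK₁_def
  set K₂ : ℝ → ℂ := fun y ↦ kθ (y + 2 * c) with hK₂_def
  have hK₁ : IsWeilTest K₁ := isWeilTest_comp_sub hk (2 * c)
  have hK₂ : IsWeilTest K₂ := by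
    have := isWeilTest_recentre hk (2 * c); exact this
  have kuv : weilConv u (weilReflect v) = K₁ := by
    rw [hu_def, hv_def, weilConv_translate_weilReflect_translate]
    funext y; simp only [hK₁_def, hk_def]; ring_nf
  have kvu : weilConv v (weilReflect u) = K₂ := by
    rw [hu_def, hv_def, weilConv_translate_weilReflect_translate]
    funext y; simp only [hK₂_def, hk_def]; ring_nf
  have kuw : weilConv u (weilReflect w) = fun y ↦ (-1 : ℂ) * K₁ y := by
    rw [hww, weilConv_const_mul_right, kuv]
  have kwu : weilConv w (weilReflect u) = fun y ↦ (-1 : ℂ) * K₂ y := by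
    rw [hw_def, weilConv_const_mul_left, kvu]
  -- `Q(G) = 2 Q(θ) − W(K₁) − W(K₂)`
  have hQu : weilQuadratic u = weilQuadratic θ := weilQuadratic_translate θ c
  have hQw : weilQuadratic w = weilQuadratic θ := by
    rw [hw_def, weilQuadratic_const_mul, hv_def, weilQuadratic_translate]
    simp
  have hQG : weilQuadratic (fun x ↦ θ (x - c) - θ (x + c)) =
      2 * weilQuadratic θ - weilFunctional K₁ - weilFunctional K₂ := by
    rw [hG, weilQuadratic_add hu hw, hQu, hQw, kuw, kwu, weilFunctional_const_mul, weilFunctional_const_mul]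
    ring
  -- prime terms of `K₁`, `K₂`: the atom `q` only
  have hvan := translate_log_vanish (k := kθ) hq.two_le h2δ hkz
  obtain ⟨hne, ⟨hkL, hkL'⟩, ⟨hk2L, hk2L'⟩⟩ := hvan
  have hΛ : ((Λ q : ℝ) : ℂ) / (Real.sqrt q : ℂ) = ((Real.log q / Real.sqrt q : ℝ) : ℂ) := by
    rw [ArithmeticFunction.vonMangoldt_apply_prime hq]; push_cast; ring
  have hP₁ : weilPrimeTerm K₁ = ((Real.log q / Real.sqrt q * N2 : ℝ) : ℂ) := by
    rw [weilPrimeTerm_eq_single q (fun n hn ↦ ?_), hΛ]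
    · simp only [hK₁_def]
      rw [← hL, sub_self, hk0, show -Real.log q - Real.log q = -(2 * Real.log q) by ring, hk2L', add_zero]
      push_cast; ring
    · simp only [hK₁_def, ← hL]
      exact (hne n hn).1
  have hP₂ : weilPrimeTerm K₂ = ((Real.log q / Real.sqrt q * N2 : ℝ) : ℂ) := by
    rw [weilPrimeTerm_eq_single q (fun n hn ↦ ?_), hΛ]
    · simp only [hK₂_def]
      rw [← hL, ← two_mul, hk2L, neg_add_cancel, hk0, zero_add]
      push_cast; ring
    · simp only [hK₂_def, ← hL]
      exact (hne n hn).2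
  -- polar terms of `K₁ + K₂`
  have hPol : weilPolarTerm K₁ + weilPolarTerm K₂ =
      ((Real.exp c + Real.exp (-c) : ℝ) : ℂ) * weilPolarTerm kθ :=
    weilPolarTerm_comp_sub_add_comp_add kθ c
  have hPolk : weilPolarTerm kθ = ((2 * (weilMellin θ 0 * conj (weilMellin θ 1)).re : ℝ) : ℂ) :=
    weilPolarTerm_weilConv_weilReflect hθ
  -- the polar term of `θ` is essentially non-negative: `2 Re(a·conj b) ≥ −‖a − b‖²`
  have hab : -(‖weilMellin θ 0 - weilMellin θ 1‖ ^ 2) ≤ 2 * (weilMellin θ 0 * conj (weilMellin θ 1)).re := by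
    have h := Complex.normSq_sub (weilMellin θ 0) (weilMellin θ 1)
    rw [Complex.normSq_eq_norm_sq, Complex.normSq_eq_norm_sq, Complex.normSq_eq_norm_sq] at h
    nlinarith [norm_nonneg (weilMellin θ 0), norm_nonneg (weilMellin θ 1), sq_nonneg ‖weilMellin θ 0‖,
      sq_nonneg ‖weilMellin θ 1‖]
  -- `‖θ̂(0) − θ̂(1)‖ ≤ 2δ‖θ‖₁`
  have hθ1 : Integrable fun t : ℝ ↦ ‖θ t‖ := (hθ.1.continuous.integrable_of_hasCompactSupport hθ.2).norm
  have hdiff : ‖weilMellin θ 0 - weilMellin θ 1‖ ≤ 2 * δ * ∫ t : ℝ, ‖θ t‖ := by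
    have hi0 : Integrable fun t : ℝ ↦ θ t * cexp ((0 - 1 / 2) * t) :=
      hθ.integrable_mul (by fun_prop)
    have hi1 : Integrable fun t : ℝ ↦ θ t * cexp ((1 - 1 / 2) * t) :=
      hθ.integrable_mul (by fun_prop)
    unfold weilMellin
    rw [← integral_sub hi0 hi1]
    calc ‖∫ t : ℝ, (θ t * cexp ((0 - 1 / 2) * t) - θ t * cexp ((1 - 1 / 2) * t))‖
        ≤ ∫ t : ℝ, ‖θ t * cexp ((0 - 1 / 2) * t) - θ t * cexp ((1 - 1 / 2) * t)‖ :=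
          norm_integral_le_integral_norm _
      _ ≤ ∫ t : ℝ, 2 * δ * ‖θ t‖ := by
          refine integral_mono_of_nonneg (Eventually.of_forall fun _ ↦ norm_nonneg _) (hθ1.const_mul _)
            (Eventually.of_forall fun t ↦ ?_)
          beta_reduce
          by_cases hft : θ t = 0
          · simp [hft]
          · have ht : t ∈ Icc (-δ) δ := hθs (subset_tsupport _ (Function.mem_support.2 hft))
            rw [Set.mem_Icc] at ht
            have hta : |t / 2| ≤ 1 := by rw [abs_le]; constructor <;> linarith
            have e0 : cexp ((0 - 1 / 2) * (t : ℂ)) = (Real.exp (-(t / 2)) : ℂ) := by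
              rw [Complex.ofReal_exp]; congr 1; push_cast; ring
            have e1 : cexp ((1 - 1 / 2) * (t : ℂ)) = (Real.exp (t / 2) : ℂ) := by
              rw [Complex.ofReal_exp]; congr 1; push_cast; ring
            rw [← mul_sub, norm_mul, e0, e1, ← Complex.ofReal_sub, Complex.norm_real, Real.norm_eq_abs]
            have hA : |Real.exp (-(t / 2)) - Real.exp (t / 2)| ≤ 2 * δ := by
              have h1 := Real.abs_exp_sub_one_le (x := t / 2) hta
              have h2 := Real.abs_exp_sub_one_le (x := -(t / 2)) (by rwa [abs_neg])
              calc |Real.exp (-(t / 2)) - Real.exp (t / 2)|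
                  = |(Real.exp (-(t / 2)) - 1) - (Real.exp (t / 2) - 1)| := by ring_nf
                _ ≤ |Real.exp (-(t / 2)) - 1| + |Real.exp (t / 2) - 1| := abs_sub _ _
                _ ≤ 2 * |-(t / 2)| + 2 * |t / 2| := by linarith
                _ ≤ 2 * δ := by
                    rw [abs_neg, abs_div, abs_two]
                    have : |t| ≤ δ := abs_le.2 ⟨ht.1, ht.2⟩
                    linarith
            calc ‖θ t‖ * |Real.exp (-(t / 2)) - Real.exp (t / 2)| ≤ ‖θ t‖ * (2 * δ) :=
                  mul_le_mul_of_nonneg_left hA (norm_nonneg _)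
              _ = 2 * δ * ‖θ t‖ := by ring
      _ = 2 * δ * ∫ t : ℝ, ‖θ t‖ := integral_const_mul _ _
  have hL1 : (∫ t : ℝ, ‖θ t‖) ^ 2 ≤ (δ - -δ) * N2 := sq_integral_norm_le_length_mul hθ (by linarith) hθs
  have hL1' : ‖weilMellin θ 0 - weilMellin θ 1‖ ^ 2 ≤ 8 * δ ^ 3 * N2 := by
    have hA0 : 0 ≤ ∫ t : ℝ, ‖θ t‖ := integral_nonneg fun _ ↦ norm_nonneg _
    calc ‖weilMellin θ 0 - weilMellin θ 1‖ ^ 2 ≤ (2 * δ * ∫ t : ℝ, ‖θ t‖) ^ 2 :=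
          pow_le_pow_left₀ (norm_nonneg _) hdiff 2
      _ = 4 * δ ^ 2 * (∫ t : ℝ, ‖θ t‖) ^ 2 := by ring
      _ ≤ 4 * δ ^ 2 * ((δ - -δ) * N2) := mul_le_mul_of_nonneg_left hL1 (by positivity)
      _ = 8 * δ ^ 3 * N2 := by ring
  -- archimedean terms of `K₁`, `K₂`
  have hc' : 0 < c - δ := by linarith
  have hA₁ : ‖weilArchTerm K₁‖ ≤ 2 * ((c + δ) - (c - δ)) * archGapBound (c - δ) * N2 := by
    refine norm_weilArchTerm_le_of_lag_support hK₁ hc' (by linarith) (fun y hy ↦ ?_) (fun y hy ↦ ?_)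
      (fun t ht ↦ ?_)
    · simp only [hK₁_def]
      refine hkz _ ?_
      have := (abs_lt.1 hy).2
      rw [abs_of_neg (by linarith)]; linarith
    · simp only [hK₁_def]
      refine hkz _ ?_
      rcases le_or_gt 0 y with h0 | h0
      · rw [abs_of_nonneg h0] at hy; rw [abs_of_pos (by linarith)]; linarith
      · rw [abs_of_neg h0] at hy; rw [abs_of_neg (by linarith)]; linarith
    · simp only [hK₁_def]
      rw [hkz (-t - 2 * c) (by rw [abs_of_neg (by linarith)]; linarith), add_zero]
      exact hkN _
  have hA₂ : ‖weilArchTerm K₂‖ ≤ 2 * ((c + δ) - (c - δ)) * archGapBound (c - δ) * N2 := by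
    refine norm_weilArchTerm_le_of_lag_support hK₂ hc' (by linarith) (fun y hy ↦ ?_) (fun y hy ↦ ?_)
      (fun t ht ↦ ?_)
    · simp only [hK₂_def]
      refine hkz _ ?_
      have := (abs_lt.1 hy).1
      rw [abs_of_pos (by linarith)]; linarith
    · simp only [hK₂_def]
      refine hkz _ ?_
      rcases le_or_gt 0 y with h0 | h0
      · rw [abs_of_nonneg h0] at hy; rw [abs_of_pos (by linarith)]; linarith
      · rw [abs_of_neg h0] at hy; rw [abs_of_neg (by linarith)]; linarith
    · simp only [hK₂_def]
      rw [hkz (t + 2 * c) (by rw [abs_of_pos (by linarith)]; linarith), zero_add]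
      exact hkN _
  -- assemble real parts
  have hre : (weilQuadratic (fun x ↦ θ (x - c) - θ (x + c))).re =
      2 * (weilQuadratic θ).re + 2 * (Real.log q / Real.sqrt q * N2)
        - (Real.exp c + Real.exp (-c)) * (2 * (weilMellin θ 0 * conj (weilMellin θ 1)).re)
        - (weilArchTerm K₁).re - (weilArchTerm K₂).re := by
    rw [hQG]
    unfold weilFunctional
    have e1 : (weilPolarTerm K₁ - weilPrimeTerm K₁ + weilArchTerm K₁).re +
        (weilPolarTerm K₂ - weilPrimeTerm K₂ + weilArchTerm K₂).re =
        (weilPolarTerm K₁ + weilPolarTerm K₂).re - (weilPrimeTerm K₁).re - (weilPrimeTerm K₂).re +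
          (weilArchTerm K₁).re + (weilArchTerm K₂).re := by
      simp only [Complex.add_re, Complex.sub_re]; ring
    have e2 : (2 * weilQuadratic θ - (weilPolarTerm K₁ - weilPrimeTerm K₁ + weilArchTerm K₁) -
        (weilPolarTerm K₂ - weilPrimeTerm K₂ + weilArchTerm K₂)).re =
        2 * (weilQuadratic θ).re - ((weilPolarTerm K₁ - weilPrimeTerm K₁ + weilArchTerm K₁).re +
          (weilPolarTerm K₂ - weilPrimeTerm K₂ + weilArchTerm K₂).re) := by
      simp only [Complex.sub_re, Complex.mul_re, Complex.re_ofNat, Complex.im_ofNat, zero_mul, sub_zero]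
      ring
    rw [e2, e1, hPol, hPolk, hP₁, hP₂, ← Complex.ofReal_mul, Complex.ofReal_re, Complex.ofReal_re]
    ring
  rw [hre]
  have hB₁ := (Complex.abs_re_le_norm (weilArchTerm K₁)).trans hA₁
  have hB₂ := (Complex.abs_re_le_norm (weilArchTerm K₂)).trans hA₂
  have hE0 : 0 ≤ Real.exp c + Real.exp (-c) := by positivity
  have hab' : -(8 * δ ^ 3 * N2) ≤ 2 * (weilMellin θ 0 * conj (weilMellin θ 1)).re :=
    (neg_le_neg hL1').trans hab
  have hpol : -((Real.exp c + Real.exp (-c)) * (2 * (weilMellin θ 0 * conj (weilMellin θ 1)).re)) ≤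
      (Real.exp c + Real.exp (-c)) * (8 * δ ^ 3 * N2) := by
    have := mul_le_mul_of_nonneg_left hab' hE0
    linarith [this]
  have hM0 : 0 ≤ archGapBound (c - δ) := (archGapBound_pos hc').le
  rw [abs_le] at hB₁ hB₂
  have h1 := hB₁.1
  have h2 := hB₂.1
  ring_nf at h1 h2 hpol ⊢
  linarith

end Pair

end Summit.RiemannHypothesis.RiemannHypothesis.Theorems.Handoff

end
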